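import Literature.AlgebraicGeometry.Resolution.RidgeIdealAdditive
import Literature.AlgebraicGeometry.Hironaka2017.EdgeInvAnyField
import Literature.RingTheory.KrullDimension.AffineCatenary
import HarnessLib

/-!
# The dimension of the ridge: `dim Rid(C) = n − r`, with `r` the number of generators of Hironaka's triangular basis
# of the ridge algebra — the second component of Hironaka's edge datum `Inv = (n, n − r, q₁, …, q_r)`
# (Giraud 1975 §1.6 (3), Lemme 1.7; Hironaka 2017 Eq. (34); CJS 2020 Rem. 18.29)

Topic: `Literature/AlgebraicGeometry/Resolution`. Sequel of `RidgeIdealAdditive.lean` (Giraud's structure theorem: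
the ideal `𝔉 = ridgeIdeal I` of the ridge of a homogeneous ideal `I ⊆ S = K[X_1, …, X_n]` is generated by its additive
homogeneous `p`-forms), `PointBlowupRidge.lean` (`ridgeAlgebra p I = U`, the subalgebra generated by those forms, and
Hironaka's edge datum `ridgeEdgeInv p I = (q₁ ≤ … ≤ q_r)` of `U`) and `Hironaka2017/EdgeInvAnyField.lean` (triangular
presentations `U = K[σ_1, …, σ_r]`, `σ_j = X_{ι(j)}^{q_j} + Σ_{k ∉ {ι(1),…,ι(j)}} c_{jk} X_k^{q_j}`, any field).

> **Giraud 1975, §1.6 (3) and p. 204.** "(3) `σ_i = X_i^{q(i)} + Σ_{j>i} c_{ij} X_j^{q(i)}`, `1 ≤ i ≤ e` … `F` admet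
> pour équations les `σ_i`". **Ridge.lean, docstring of `ridgeDim`.** "By Hironaka's structure theorem `𝔉 = ⟨σ_1, …,
> σ_s⟩` with `σ_i` triangular, and then `dim F = n − s` (not proved here)." **PointBlowupRidge.lean, `ridgeEdgeInv`.**
> "`n − r = dim Rid` when `𝔉 = U₊S` (`RidgeIdealSpanAdditive`)."

PROVED here, for a HOMOGENEOUS ideal `I` over a field `K` of exponential characteristic `p` and any triangular
presentation `P` of the ridge algebra `U = ridgeAlgebra p I`:
* `ridgeIdeal_eq_span_range_gen` — **`𝔉 = (σ_1, …, σ_r)`**: the triangular generators of `U` generate the ideal of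
  the ridge (Giraud's theorem + «a constant-free element of `K[G]` lies in the ideal `(G)`»);
* `isIntegral_quotient_ridgeIdeal` — `S/𝔉` is INTEGRAL over the subalgebra generated by the non-pivot variables
  (each pivot variable satisfies the monic equation `σ_j = 0` over the later pivots and the non-pivots: echelon form);
* `ringKrullDim_quotient_ridgeIdeal_le` — hence `dim S/𝔉 ≤ n − r`, and with the dimension formula for the affine
  domain `S` (`Literature.RingTheory.KrullDimension.ringKrullDim_quotient_add_height`) every prime over `𝔉` has
  height `≥ r`; Krull's height theorem gives `≤ r`:
* **`height_ridgeIdeal_eq`** — `ht 𝔉 = r`; **`ridgeDim_eq_sub_r`** — `dim Rid = ridgeDim I = n − r`; and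
  **`ridgeDim_eq_sub_ridgeEdgeInv_r`** — `dim Rid = n − (ridgeEdgeInv p I).r`, the second component of Hironaka's
  edge datum of the ridge, now unconditionally.

Written for the cell res-hironaka (seat res-L1-s46-pv-7, W4.6 rung (iv)); AI-written; AI review is weaker than expert
review.

## References

* J. Giraud, *Contact maximal en caractéristique positive*, Ann. Sci. ÉNS (4) 8 (1975), §1.5–1.6, Lemme 1.7. [Giraud1975]
* H. Hironaka, *Additive groups associated with points of a projective space*, Ann. of Math. 92 (1970). [Hironaka1970AdditiveGroups]
* V. Cossart, U. Jannsen, S. Saito, LNM 2270 (2020), Remark 18.29 (`dim` of the ridge). [CossartJannsenSaito2020]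
* H. Matsumura, *Commutative Ring Theory*, Thm 5.6, Thm 9.3 (dimension formula; integral extensions). [Matsumura1987]
-/

noncomputable section

open MvPolynomial
open Literature.AlgebraicGeometry.Hironaka2017.EdgeAlgebra
open Literature.AlgebraicGeometry.Hironaka2017.Datum
open Literature.RingTheory.KrullDimension

namespace Literature.AlgebraicGeometry.Resolution

universe u

variable {K : Type u} [Field K] {n : ℕ} {p : ℕ}

/-! ## 1. The triangular generators of the ridge algebra generate the ridge ideal -/

section Generators

/-- A constant-free element of the subalgebra generated by constant-free polynomials lies in the IDEAL they
generate. [folklore] -/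
private theorem mem_ideal_span_of_mem_adjoin' {G : Set (MvPolynomial (Fin n) K)} (hG : ∀ g ∈ G, constantCoeff g = 0)
    {b : MvPolynomial (Fin n) K} (hb : b ∈ Algebra.adjoin K G) (hb0 : constantCoeff b = 0) : b ∈ Ideal.span G := by
  suffices h : b - C (constantCoeff b) ∈ Ideal.span G by rwa [hb0, C_0, sub_zero] at h
  clear hb0
  induction hb using Algebra.adjoin_induction with
  | mem x hx =>
    rw [hG x hx, C_0, sub_zero]
    exact Ideal.subset_span hx
  | algebraMap c => rw [MvPolynomial.algebraMap_eq, constantCoeff_C, sub_self]; exact Ideal.zero_mem _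
  | add x y _ _ hx hy =>
    have : x + y - C (constantCoeff (x + y)) = (x - C (constantCoeff x)) + (y - C (constantCoeff y)) := by
      rw [map_add, map_add]; ring
    rw [this]; exact Ideal.add_mem _ hx hy
  | mul x y _ _ hx hy =>
    have : x * y - C (constantCoeff (x * y)) =
        x * (y - C (constantCoeff y)) + C (constantCoeff y) * (x - C (constantCoeff x)) := by
      rw [map_mul, map_mul]; ring
    rw [this]
    exact Ideal.add_mem _ (Ideal.mul_mem_left _ _ hy) (Ideal.mul_mem_left _ _ hx)

/-- A form `Σ_k c_k X_k^{p^e}` (`p ≥ 1`) has no constant term. [folklore] -/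
private theorem constantCoeff_sum_C_mul_X_pow (c : Fin n → K) {q : ℕ} (hq : 1 ≤ q) :
    constantCoeff (∑ k, C (c k) * X k ^ q : MvPolynomial (Fin n) K) = 0 := by
  rw [map_sum]
  refine Finset.sum_eq_zero fun k _ => ?_
  rw [map_mul, map_pow, constantCoeff_X, zero_pow (by omega), mul_zero]

variable [ExpChar K p] {I : Ideal (MvPolynomial (Fin n) K)}

/-- The additive forms `ridgeForm p I j` have no constant term. [folklore] -/
private theorem constantCoeff_ridgeForm (j : RidgeFormIndex p I) : constantCoeff (ridgeForm p I j) = 0 :=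
  constantCoeff_sum_C_mul_X_pow _ (Nat.one_le_pow _ _ (expChar_pos K p))

/-- The triangular generators have no constant term. [folklore] -/
private theorem constantCoeff_gen (P : TriangularPresentation p (ridgeAlgebra p I)) (j : Fin P.r) :
    constantCoeff (P.gen j) = 0 :=
  constantCoeff_sum_C_mul_X_pow _ (P.one_le_q j)

/-- **`𝔉 = (σ_1, …, σ_r)`: the generators of any triangular presentation of the ridge algebra `U` generate the ideal of
the ridge** (for `I` homogeneous: Giraud's structure theorem `𝔉 = ⟨additive forms of 𝔉⟩`, and the additive forms and
the `σ_j` generate the same subalgebra `U`, all without constant term). [cite: Giraud1975, §1.6 (3)] -/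
theorem ridgeIdeal_eq_span_range_gen (hI : ∀ f ∈ I, ∀ d : ℕ, homogeneousComponent d f ∈ I)
    (P : TriangularPresentation p (ridgeAlgebra p I)) : ridgeIdeal I = Ideal.span (Set.range P.gen) := by
  have hGir := ridgeIdealSpanAdditive_of_isHomogeneous p hI
  unfold RidgeIdealSpanAdditive at hGir
  apply le_antisymm
  · rw [hGir]
    refine Ideal.span_le.mpr ?_
    rintro _ ⟨j, rfl⟩
    -- `ridgeForm p I j ∈ U = K[σ]` and has no constant term
    have hmem : ridgeForm p I j ∈ Algebra.adjoin K (Set.range P.gen) := by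
      rw [show Algebra.adjoin K (Set.range P.gen) = ridgeAlgebra p I from P.eq_adjoin.symm]
      exact Algebra.subset_adjoin ⟨j, rfl⟩
    exact mem_ideal_span_of_mem_adjoin' (by rintro _ ⟨i, rfl⟩; exact constantCoeff_gen P i) hmem
      (constantCoeff_ridgeForm j)
  · refine Ideal.span_le.mpr ?_
    rintro _ ⟨j, rfl⟩
    rw [SetLike.mem_coe, hGir]
    exact mem_ideal_span_of_mem_adjoin' (by rintro _ ⟨i, rfl⟩; exact constantCoeff_ridgeForm i) (P.gen_mem j)
      (constantCoeff_gen P j)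

/-- **Krull: `ht 𝔉 ≤ r`.** [cite: Giraud1975, §1.6 (3)] -/
theorem height_ridgeIdeal_le_r (hI : ∀ f ∈ I, ∀ d : ℕ, homogeneousComponent d f ∈ I)
    (P : TriangularPresentation p (ridgeAlgebra p I)) : (ridgeIdeal I).height ≤ P.r := by
  classical
  have hspan : ridgeIdeal I = Ideal.span ((Finset.univ.image P.gen : Finset _) : Set (MvPolynomial (Fin n) K)) := by
    rw [ridgeIdeal_eq_span_range_gen hI P, Finset.coe_image, Finset.coe_univ, Set.image_univ]
  have hfin : (ridgeIdeal I).spanFinrank ≤ (Finset.univ.image P.gen).card := by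
    have h := Submodule.spanFinrank_span_le_ncard_of_finite (R := MvPolynomial (Fin n) K)
      (Finset.univ.image P.gen).finite_toSet
    rw [Set.ncard_coe_finset] at h
    rw [hspan]
    exact h
  calc (ridgeIdeal I).height ≤ ((ridgeIdeal I).spanFinrank : ℕ∞) := Ideal.height_le_spanFinrank _ (ridgeIdeal_ne_top I)
    _ ≤ (P.r : ℕ∞) := by
        have hc : (Finset.univ.image P.gen).card ≤ P.r := by
          calc (Finset.univ.image P.gen).card ≤ (Finset.univ : Finset (Fin P.r)).card := Finset.card_image_le
            _ = P.r := by simp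
        exact_mod_cast hfin.trans hc

end Generators

/-! ## 2. `S/𝔉` is integral over the non-pivot variables -/

section Integral

variable [ExpChar K p] {I : Ideal (MvPolynomial (Fin n) K)}

/-- **Every variable is integral over the non-pivot variables modulo `𝔉`**: the pivot variable `X_{ι(j)}` satisfies
`X_{ι(j)}^{q_j} = −Σ_{k ∉ {ι(1),…,ι(j)}} c_{jk} X_k^{q_j}` modulo `σ_j ∈ 𝔉`, whose right-hand side only involves
non-pivots and LATER pivots (echelon form); descending induction on `j`. [cite: Giraud1975, §1.6 (3)] -/
theorem isIntegral_mk_X (hI : ∀ f ∈ I, ∀ d : ℕ, homogeneousComponent d f ∈ I)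
    (P : TriangularPresentation p (ridgeAlgebra p I)) (i : Fin n) :
    IsIntegral (Algebra.adjoin K (Set.range fun k : {k : Fin n // k ∉ Set.range P.pivot} =>
      Ideal.Quotient.mk (ridgeIdeal I) (X k.1 : MvPolynomial (Fin n) K))) (Ideal.Quotient.mk (ridgeIdeal I) (X i : MvPolynomial (Fin n) K)) := by
  classical
  set Q := MvPolynomial (Fin n) K ⧸ ridgeIdeal I
  set B : Subalgebra K Q := Algebra.adjoin K (Set.range fun k : {k : Fin n // k ∉ Set.range P.pivot} =>
      Ideal.Quotient.mk (ridgeIdeal I) (X k.1 : MvPolynomial (Fin n) K)) with hB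
  set A : Subalgebra K Q := (integralClosure B Q).restrictScalars K with hA
  -- membership in `A` is integrality over `B`
  have hA_iff : ∀ y : Q, y ∈ A ↔ IsIntegral B y := fun y => by
    rw [hA, Subalgebra.mem_restrictScalars, mem_integralClosure_iff]
  -- non-pivot variables lie in `B ⊆ A`
  have hnon : ∀ k : Fin n, k ∉ Set.range P.pivot → Ideal.Quotient.mk (ridgeIdeal I) (X k) ∈ A := by
    intro k hk
    rw [hA_iff]
    have hkB : Ideal.Quotient.mk (ridgeIdeal I) (X k) ∈ B := Algebra.subset_adjoin ⟨⟨k, hk⟩, rfl⟩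
    have h : IsIntegral B (algebraMap B Q ⟨_, hkB⟩) := isIntegral_algebraMap
    exact h
  -- pivot variables, by descending induction on the pivot index
  have hpiv : ∀ m : ℕ, ∀ j : Fin P.r, P.r = j.val + m + 1 → Ideal.Quotient.mk (ridgeIdeal I) (X (P.pivot j)) ∈ A := by
    intro m
    induction m using Nat.strong_induction_on with
    | _ m ih =>
      intro j hjm
      -- the relation `σ_j = 0` in `Q`
      have hrel : Ideal.Quotient.mk (ridgeIdeal I) (P.gen j) = 0 :=
        Ideal.Quotient.eq_zero_iff_mem.mpr (by rw [ridgeIdeal_eq_span_range_gen hI P]; exact Ideal.subset_span ⟨j, rfl⟩)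
      rw [TriangularPresentation.gen, map_sum, ← Finset.add_sum_erase _ _ (Finset.mem_univ (P.pivot j)),
        P.coef_pivot, C_1, one_mul, map_pow, add_eq_zero_iff_eq_neg] at hrel
      -- the remaining sum lies in `A`
      have hsum : (∑ k ∈ Finset.univ.erase (P.pivot j),
          Ideal.Quotient.mk (ridgeIdeal I) (C (P.coef j k) * X k ^ p ^ P.expo j)) ∈ A := by
        refine Subalgebra.sum_mem _ fun k hk => ?_
        rw [map_mul, map_pow, ← MvPolynomial.algebraMap_eq, Ideal.Quotient.mk_algebraMap]
        by_cases hkp : k ∈ Set.range P.pivot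
        · obtain ⟨j', rfl⟩ := hkp
          have hne : j' ≠ j := fun h => (Finset.mem_erase.mp hk).1 (by rw [h])
          rcases lt_or_gt_of_ne hne with hlt | hgt
          · -- earlier pivot: coefficient zero
            rw [P.coef_pivot_eq_zero j j' hlt, map_zero, zero_mul]
            exact A.zero_mem
          · -- later pivot: induction hypothesis
            have hj' : P.r = j'.val + (P.r - j'.val - 1) + 1 := by omega
            exact A.mul_mem (A.algebraMap_mem _) (A.pow_mem (ih (P.r - j'.val - 1) (by omega) j' hj') _)
        · exact A.mul_mem (A.algebraMap_mem _) (A.pow_mem (hnon k hkp) _)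
      -- `x^{q_j} = -a` with `a` integral, so `x` is integral
      rw [hA_iff]
      refine IsIntegral.of_pow (pow_pos (expChar_pos K p) (P.expo j)) ?_
      rw [hrel]
      exact ((hA_iff _).mp hsum).neg
  by_cases hi : i ∈ Set.range P.pivot
  · obtain ⟨j, rfl⟩ := hi
    exact (hA_iff _).mp (hpiv (P.r - j.val - 1) j (by omega))
  · exact (hA_iff _).mp (hnon i hi)

/-- **`S/𝔉` is integral over the subalgebra of the non-pivot variables.** [cite: Giraud1975, §1.6 (3)] -/
theorem isIntegral_quotient_ridgeIdeal (hI : ∀ f ∈ I, ∀ d : ℕ, homogeneousComponent d f ∈ I)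
    (P : TriangularPresentation p (ridgeAlgebra p I)) :
    Algebra.IsIntegral (Algebra.adjoin K (Set.range fun k : {k : Fin n // k ∉ Set.range P.pivot} =>
      Ideal.Quotient.mk (ridgeIdeal I) (X k.1 : MvPolynomial (Fin n) K))) (MvPolynomial (Fin n) K ⧸ ridgeIdeal I) := by
  rw [← integralClosure_eq_top_iff, eq_top_iff]
  -- `S/𝔉` is generated over `K` by the images of the variables, all integral
  have hgen : Algebra.adjoin K (Set.range fun i : Fin n => Ideal.Quotient.mk (ridgeIdeal I) (X i : MvPolynomial (Fin n) K)) = ⊤ := by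
    have hrange : (Set.range fun i : Fin n => Ideal.Quotient.mk (ridgeIdeal I) (X i : MvPolynomial (Fin n) K)) =
        Ideal.Quotient.mkₐ K (ridgeIdeal I) '' Set.range (X : Fin n → MvPolynomial (Fin n) K) := by
      rw [← Set.range_comp]; rfl
    rw [hrange, Algebra.adjoin_image, MvPolynomial.adjoin_range_X, Algebra.map_top, AlgHom.range_eq_top]
    exact Ideal.Quotient.mkₐ_surjective K _
  intro y _
  have hy : y ∈ (Algebra.adjoin K (Set.range fun i : Fin n => Ideal.Quotient.mk (ridgeIdeal I) (X i))) := by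
    rw [hgen]; exact Algebra.mem_top
  have hle : Algebra.adjoin K (Set.range fun i : Fin n => Ideal.Quotient.mk (ridgeIdeal I) (X i : MvPolynomial (Fin n) K)) ≤
      (integralClosure (Algebra.adjoin K (Set.range fun k : {k : Fin n // k ∉ Set.range P.pivot} =>
      Ideal.Quotient.mk (ridgeIdeal I) (X k.1 : MvPolynomial (Fin n) K))) (MvPolynomial (Fin n) K ⧸ ridgeIdeal I)).restrictScalars K := by
    refine Algebra.adjoin_le ?_
    rintro _ ⟨i, rfl⟩
    rw [SetLike.mem_coe, Subalgebra.mem_restrictScalars, mem_integralClosure_iff]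
    exact isIntegral_mk_X hI P i
  exact hle hy

omit [ExpChar K p] in
/-- The non-pivot subalgebra has dimension at most `n − r` (a quotient of a polynomial ring in `n − r` variables).
[folklore] -/
private theorem ringKrullDim_nonPivotAlgebra_le (P : TriangularPresentation p (ridgeAlgebra p I)) :
    ringKrullDim (Algebra.adjoin K (Set.range fun k : {k : Fin n // k ∉ Set.range P.pivot} =>
      Ideal.Quotient.mk (ridgeIdeal I) (X k.1 : MvPolynomial (Fin n) K))) ≤ (n - P.r : ℕ) := by
  classical
  set φ : MvPolynomial {k : Fin n // k ∉ Set.range P.pivot} K →ₐ[K] MvPolynomial (Fin n) K ⧸ ridgeIdeal I :=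
    MvPolynomial.aeval fun k : {k : Fin n // k ∉ Set.range P.pivot} =>
      Ideal.Quotient.mk (ridgeIdeal I) (X k.1 : MvPolynomial (Fin n) K) with hφ
  have hsurj : Function.Surjective φ.rangeRestrict := AlgHom.rangeRestrict_surjective φ
  have heq : φ.range = Algebra.adjoin K (Set.range fun k : {k : Fin n // k ∉ Set.range P.pivot} =>
      Ideal.Quotient.mk (ridgeIdeal I) (X k.1 : MvPolynomial (Fin n) K)) := by
    rw [Algebra.adjoin_range_eq_range_aeval]
  have h := ringKrullDim_le_of_surjective φ.rangeRestrict.toRingHom hsurj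
  rw [MvPolynomial.ringKrullDim_of_isNoetherianRing, ringKrullDim_eq_zero_of_field, zero_add] at h
  have hcard : Nat.card {k : Fin n // k ∉ Set.range P.pivot} = n - P.r := by
    rw [Nat.card_eq_fintype_card, Fintype.card_subtype_compl, Fintype.card_fin,
      Set.card_range_of_injective P.pivot_injective, Fintype.card_fin]
  rw [hcard] at h
  rw [← heq]
  exact h

/-- **`dim S/𝔉 ≤ n − r`** (integral over a quotient of a polynomial ring in `n − r` variables).
[cite: CossartJannsenSaito2020, Remark 18.29] -/
theorem ringKrullDim_quotient_ridgeIdeal_le (hI : ∀ f ∈ I, ∀ d : ℕ, homogeneousComponent d f ∈ I)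
    (P : TriangularPresentation p (ridgeAlgebra p I)) :
    ringKrullDim (MvPolynomial (Fin n) K ⧸ ridgeIdeal I) ≤ (n - P.r : ℕ) := by
  haveI := isIntegral_quotient_ridgeIdeal hI P
  exact (ringKrullDim_le_of_isIntegral (R := Algebra.adjoin K (Set.range fun k : {k : Fin n // k ∉ Set.range P.pivot} =>
      Ideal.Quotient.mk (ridgeIdeal I) (X k.1 : MvPolynomial (Fin n) K)))).trans (ringKrullDim_nonPivotAlgebra_le P)

end Integral

/-! ## 3. `ht 𝔉 = r` and `dim Rid = n − r` -/

section Dimension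

variable [ExpChar K p] {I : Ideal (MvPolynomial (Fin n) K)}

/-- **Every prime over `𝔉` has height `≥ r`** (dimension formula for the affine domain `S`: `dim S/𝔓 + ht 𝔓 = n`, and
`dim S/𝔓 ≤ dim S/𝔉 ≤ n − r`). [cite: Matsumura1987, Thm 5.6] -/
theorem le_height_of_ridgeIdeal_le (hI : ∀ f ∈ I, ∀ d : ℕ, homogeneousComponent d f ∈ I)
    (P : TriangularPresentation p (ridgeAlgebra p I)) {𝔓 : Ideal (MvPolynomial (Fin n) K)} [𝔓.IsPrime]
    (h𝔓 : ridgeIdeal I ≤ 𝔓) : (P.r : ℕ∞) ≤ 𝔓.height := by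
  -- `dim S/𝔓 ≤ n - r`
  have hquot : ringKrullDim (MvPolynomial (Fin n) K ⧸ 𝔓) ≤ (n - P.r : ℕ) :=
    (ringKrullDim_le_of_surjective (Ideal.Quotient.factor h𝔓) (Ideal.Quotient.factor_surjective h𝔓)).trans
      (ringKrullDim_quotient_ridgeIdeal_le hI P)
  -- the dimension formula
  obtain ⟨m, hm, -⟩ := exists_ringKrullDim_eq_and_trdeg_eq K (MvPolynomial (Fin n) K ⧸ 𝔓)
  have hformula := ringKrullDim_quotient_add_height K 𝔓
  have hfin : 𝔓.height ≠ ⊤ := by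
    have := Ideal.height_le_ringKrullDim_of_ne_top (Ideal.IsPrime.ne_top (inferInstance : 𝔓.IsPrime))
    rw [MvPolynomial.ringKrullDim_of_isNoetherianRing, ringKrullDim_eq_zero_of_field, zero_add,
      Nat.card_eq_fintype_card, Fintype.card_fin] at this
    exact ne_top_of_le_ne_top (ENat.coe_ne_top n) (by exact_mod_cast this)
  obtain ⟨h, hh⟩ := ENat.ne_top_iff_exists.mp hfin
  rw [MvPolynomial.ringKrullDim_of_isNoetherianRing, ringKrullDim_eq_zero_of_field, zero_add,
    Nat.card_eq_fintype_card, Fintype.card_fin, hm, ← hh] at hformula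
  have hmh : m + h = n := by exact_mod_cast hformula
  rw [hm] at hquot
  have hmle : m ≤ n - P.r := by exact_mod_cast hquot
  have hr : P.r ≤ n := P.r_le
  rw [← hh]
  exact_mod_cast (by omega : P.r ≤ h)

/-- **`ht 𝔉 = r`**: the height of the ideal of the ridge is the number of generators of a triangular basis of the
ridge algebra. [cite: Giraud1975, Lemme 1.7] [cite: CossartJannsenSaito2020, Remark 18.29] -/
theorem height_ridgeIdeal_eq (hI : ∀ f ∈ I, ∀ d : ℕ, homogeneousComponent d f ∈ I)
    (P : TriangularPresentation p (ridgeAlgebra p I)) : (ridgeIdeal I).height = P.r := by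
  refine le_antisymm (height_ridgeIdeal_le_r hI P) ?_
  rw [Ideal.height_eq_inf_minimalPrimes]
  refine le_iInf₂ fun 𝔓 h𝔓 => ?_
  haveI : 𝔓.IsPrime := h𝔓.1.1
  exact le_height_of_ridgeIdeal_le hI P h𝔓.1.2

/-- **`dim Rid = n − r`** (`ridgeDim I = n − ht 𝔉`). [cite: CossartJannsenSaito2020, Remark 18.29] -/
theorem ridgeDim_eq_sub_r (hI : ∀ f ∈ I, ∀ d : ℕ, homogeneousComponent d f ∈ I)
    (P : TriangularPresentation p (ridgeAlgebra p I)) : ridgeDim I = n - P.r := by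
  rw [ridgeDim, height_ridgeIdeal_eq hI P, ENat.toNat_coe]

variable (p I) in
/-- **`dim Rid = n − r` with `r = (ridgeEdgeInv p I).r` the number of exponents of Hironaka's edge datum
`Inv = (n, n − r, q₁, …, q_r)` of the ridge** — the docstring promise of `ridgeEdgeInv` («`n − r = dim Rid` when
`𝔉 = U₊S`»), now unconditional for homogeneous `I`. [cite: Hironaka2017, Eq. (34) p.24]
[cite: CossartJannsenSaito2020, Remark 18.29] -/
theorem ridgeDim_eq_sub_ridgeEdgeInv_r (hI : ∀ f ∈ I, ∀ d : ℕ, homogeneousComponent d f ∈ I) :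
    ridgeDim I = n - (ridgeEdgeInv p I).r := by
  obtain ⟨P⟩ := nonempty_triangularPresentation p (ridgeAlgebra p I) (isGradedSubalgebra_ridgeAlgebra p I)
    (isDiffStable_ridgeAlgebra p I)
  have hr : (ridgeEdgeInv p I).r = P.r := by
    rw [ridgeEdgeInv, edgeInvK_eq_toEdgeInv _ _ P, EdgeInv.r]
    exact P.length_qList
  rw [hr, ridgeDim_eq_sub_r hI P]

variable (p I) in
/-- **`ht 𝔉 = (ridgeEdgeInv p I).r`.** [cite: CossartJannsenSaito2020, Remark 18.29] -/
theorem height_ridgeIdeal_eq_ridgeEdgeInv_r (hI : ∀ f ∈ I, ∀ d : ℕ, homogeneousComponent d f ∈ I) :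
    (ridgeIdeal I).height = (ridgeEdgeInv p I).r := by
  obtain ⟨P⟩ := nonempty_triangularPresentation p (ridgeAlgebra p I) (isGradedSubalgebra_ridgeAlgebra p I)
    (isDiffStable_ridgeAlgebra p I)
  have hr : (ridgeEdgeInv p I).r = P.r := by
    rw [ridgeEdgeInv, edgeInvK_eq_toEdgeInv _ _ P, EdgeInv.r]
    exact P.length_qList
  rw [hr, height_ridgeIdeal_eq hI P]

end Dimension

end Literature.AlgebraicGeometry.Resolution

end
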